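import Summits.Ventures.Crystal3D.Theorems.StickyWulffConstantGenericWallFloorEndBallBlockerDefs
import Summits.Ventures.Crystal3D.Theorems.StickyWulffConstantGenericWallFloorEndBallClassDefs
import HarnessLib

/-!
# §51 interface — FAST EVALUATION of menu filters («filter before deduplication»): `menuFilter`, and the rewrite lemmas
# `freeSites = menuFilter …`, `blockerSites = menuFilter …` (crux `GenericWallFloor`, stmt-Ventures-19480, line `WallLedgerG`)

HONEST FRAMING. Venture `Summits/Ventures/Crystal3D` (cell `crystal3d-full`), helper vocabulary for the crux `GenericWallFloor` of
`route-Ventures-StickyWulffConstant`, REGISTERED line `WallLedgerG`, open stub `stub_twoSlabAdhesion`.  One computable definition + rewrite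
lemmas + the twelve blocker tables evaluated.  Nothing is claimed about packings; F-C1 not moved.

WHY.  `menuQ3` (…EndBallMenuDefs) is a `biUnion` of 9 × 12 × 13 = 1404 candidates deduplicated to 207; evaluating ANY filter of it in the
kernel first pays the deduplication (≈ 50 s per `decide +kernel`).  Filtering each small piece BEFORE the union (`Finset.filter_biUnion`) is
the same `Finset` and evaluates in ≈ 1 s.  So per-class / per-slot tables of the §51 interface should be evaluated through:
* `menuFilter P` — `⋃ₒ ⋃_{v′ ∈ dozenQ3 o} ((insert (−v′) ((dozenQ3 o).image (· − v′))).filter P)`;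
* `menuQ3_filter_eq : menuQ3.filter (P · = true) = menuFilter P`;
* `freeSites_eq_menuFilter`, `blockerSites_eq_menuFilter` — the interface tables as `menuFilter`s (then `decide +kernel` is seconds);
* `card_blockerSites : ∀ i, (blockerSites i).card = 7` — every slot has exactly seven blocker sites (cf. `blockerSites_zero`, …EndBallBlocker).
WHAT THIS IS NOT: no statement about configurations; F-C1 not moved.
-/

namespace Summit.Ventures.Crystal3D.Theorems

open Summit.Ventures.Crystal3D Finset NearIdentity

/-- **Filter-before-union form of a menu filter** (same `Finset` as `menuQ3.filter`, cheap to evaluate). -/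
def menuFilter (P : (Fin 3 → ℤ) → Bool) : Finset (Fin 3 → ℤ) :=
  Finset.univ.biUnion fun o : Option (Fin 8) =>
    (dozenQ3 o).biUnion fun v' => (insert (-v') ((dozenQ3 o).image fun v => v - v')).filter fun q => P q = true

/-- `menuQ3.filter P = menuFilter P`. -/
theorem menuQ3_filter_eq (P : (Fin 3 → ℤ) → Bool) : menuQ3.filter (fun q => P q = true) = menuFilter P := by
  simp only [menuQ3, menuFilter, Finset.filter_biUnion]

/-- A `Prop`-filter of the menu through its Boolean decision. -/
theorem menuQ3_filter_eq_menuFilter (p : (Fin 3 → ℤ) → Prop) [DecidablePred p] :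
    menuQ3.filter p = menuFilter fun q => decide (p q) := by
  rw [← menuQ3_filter_eq]
  exact Finset.filter_congr fun q _ => by simp

/-- **The free table as a `menuFilter`.** -/
theorem freeSites_eq_menuFilter (C : EndBallClass) (sharp : Bool) :
    C.freeSites sharp = menuFilter fun q =>
      decide (sdot3 q q ≤ 54 ∧ q ≠ 0 ∧ q ∉ C.listed ∧ C.overlaps q = false ∧ (sharp = true → sdot3 q q ≠ 18)) :=
  menuQ3_filter_eq_menuFilter _

/-- **The blocker table as a `menuFilter`.** -/
theorem blockerSites_eq_menuFilter (i : Fin 12) :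
    blockerSites i = menuFilter fun q => decide (18 ≤ sdot3 q q ∧ sdot3 (q - 3 • slotInt i) (q - 3 • slotInt i) < 18) :=
  menuQ3_filter_eq_menuFilter _

set_option maxRecDepth 200000 in
/-- **Every slot has exactly seven blocker sites** (the slot itself, four twin contacts, two twin `√2`-sites). -/
theorem card_blockerSites : ∀ i : Fin 12, (blockerSites i).card = 7 := by
  intro i
  rw [blockerSites_eq_menuFilter]
  revert i
  decide +kernel

end Summit.Ventures.Crystal3D.Theorems
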